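import Mathlib.AlgebraicGeometry.EllipticCurve.Weierstrass
import Mathlib.AlgebraicGeometry.EllipticCurve.ModelsWithJ
import Mathlib.Algebra.CubicDiscriminant
import Mathlib.FieldTheory.IsAlgClosed.Basic
import Mathlib.NumberTheory.NumberField.Basic
import Mathlib.RingTheory.Algebraic.Integral
import Literature.IUT.HodgeTheaters.KappaCoricFunctions
import Literature.IUT.HodgeTheaters.KappaCoricFunctionsExistence
import HarnessLib

/-!
# [IUTchI] Remark 3.1.7 (i)–(ii): the strictly critical locus AT THE 2-TORSION OF AN ELLIPTIC CURVE
# — a genuine (non-degenerate) kernel witness of the interface `CriticalLocus`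

S. Mochizuki, *Inter-universal Teichmüller theory I*, §3, Remark 3.1.7 (i), (ii) (kurims final
manuscript May 2020, pp. 66–67) [claim: Mochizuki2012, status: disputed]. PROOF-ONLY companion of
`Literature/IUT/HodgeTheaters/KappaCoricFunctions.lean` (statement module, abc-iut-L5-t2) and
`…/KappaCoricFunctionsExistence.lean` (dischargers); NO new definition, instance or structure.

NON-VACUITY (cell abc-iut, ADJUDICATION §4 (iii) «instantiated ≠ endorsed»; kernel inhabitant
censuses w5-d109 02:25Z / w5-d056 v2 01:14Z: `CriticalLocus` had NO kernel term of any kind while 30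
declarations quantify over it). Print (Rmk 3.1.7 (i), p. 66): the compactification `|C_L|^cpt ≅ ℙ¹`
of the coarse space of `C_L = X_L / {±1}` has "precisely `4` critical points", the cusp and the `3`
*strictly critical* points, i.e. the images of the three nonzero `2`-torsion points of `E_L`; in the
affine coordinate `x` these are the roots of the `2`-division cubic `4x³ + b₂x² + 2b₄x + b₆`
(Mathlib: `WeierstrassCurve.twoTorsionPolynomial`, "its roots over a splitting field … are
precisely the `X`-coordinates of the non-zero 2-torsion points"). We prove, with no hypothesis
beyond the printed setting (an elliptic curve over a field of characteristic `0`, read in an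
algebraically closed field `Ω ⊇ F`, print's `L̄`):

* `CriticalLocus.exists_coe_pts_eq_rootSet_twoTorsion` : `∃ S : CriticalLocus Ω` whose `pts` are
  EXACTLY the roots of `E.twoTorsionPolynomial` in `Ω` — three of them because the discriminant is
  `16·Δ_E ≠ 0` (`Cubic.card_roots_of_discr_ne_zero`);
* `CriticalLocus.mem_pts_iff_of_coe_pts_eq` : membership = the printed cubic equation;
* `CriticalLocus.isAlgebraic_of_coe_pts_eq` : over a NUMBER FIELD `F` every strictly critical point
  is algebraic over `ℚ` — precisely the standing hypothesis `hS` of the landed dischargers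
  `existsKappaCoricDegreeFour_holds` / `everyValueAttained_holds` of Rmk 3.1.7 (ii);
* `CriticalLocus.exists_twoTorsion_rmk317ii` : hence Rmk 3.1.7 (ii) ("there exists a `κ`-coric
  `f_sol` of degree `4`"; "every element of `L̄` appears as a value of some `κ`-coric rational
  function … at some point that is not critical") holds AT THE GENUINE CRITICAL LOCUS of every
  elliptic curve over a number field — before this file both theorems were quantified over an
  arbitrary `3`-element set that no kernel term supplied;
* `CriticalLocus.nonempty_model` : `Nonempty (CriticalLocus Ω)` for every algebraically closed `Ω`
  of characteristic `0` (model: the curve `WeierstrassCurve.ofJ 1728` over `ℚ`).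

Honest label: GENUINE model (the printed object), not a `Unit`/toy carrier. Nothing here bears on
the disputed parts of the series; typed ≠ proved for the rest of §3; no side taken on [IUTchIII]
Cor. 3.12.
-/

namespace Literature.IUT.HodgeTheaters.CriticalLocus

open Polynomial

universe u v

variable {F : Type v} [Field F] {Ω : Type u} [Field Ω] [Algebra F Ω]

/-- **Rmk 3.1.7 (i), p. 66 — genuine witness.** For an elliptic curve `E` over a field `F` of
characteristic `0` and an algebraically closed `Ω ⊇ F` (print: `L̄`), the roots in `Ω` of the
`2`-division cubic `4x³ + b₂x² + 2b₄x + b₆` — the `x`-coordinates of the three nonzero `2`-torsion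
points, i.e. the three strictly critical points of `|C_L|^cpt ≅ ℙ¹` — form a `CriticalLocus Ω`
("precisely `4` critical points", the fourth being the cusp `∞`): they are `3` because the
discriminant of the cubic is `16·Δ_E ≠ 0`. [claim: Mochizuki2012, status: disputed] -/
theorem exists_coe_pts_eq_rootSet_twoTorsion [CharZero F] [IsAlgClosed Ω] (E : WeierstrassCurve F)
    [E.IsElliptic] :
    ∃ S : CriticalLocus Ω, (S.pts : Set Ω) = E.twoTorsionPolynomial.toPoly.rootSet Ω := by
  classical
  have ha : E.twoTorsionPolynomial.a ≠ 0 := by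
    change (4 : F) ≠ 0
    norm_num
  have hd : E.twoTorsionPolynomial.discr ≠ 0 :=
    E.twoTorsionPolynomial_discr_ne_zero_of_isElliptic (isUnit_iff_ne_zero.mpr two_ne_zero)
  have hs : (E.twoTorsionPolynomial.toPoly.map (algebraMap F Ω)).Splits := IsAlgClosed.splits _
  refine ⟨⟨(Cubic.map (algebraMap F Ω) E.twoTorsionPolynomial).roots.toFinset,
    Cubic.card_roots_of_discr_ne_zero ha hs hd⟩, ?_⟩
  simp only [rootSet_def, Cubic.roots, Cubic.map_toPoly, aroots_def]

/-- Membership in such a locus is the printed cubic equation `4x³ + b₂x² + 2b₄x + b₆ = 0` (read in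
`Ω`): the strictly critical points are exactly the `x`-coordinates of the nonzero `2`-torsion.
[claim: Mochizuki2012, status: disputed] -/
theorem mem_pts_iff_of_coe_pts_eq [CharZero F] (E : WeierstrassCurve F) (S : CriticalLocus Ω)
    (hS : (S.pts : Set Ω) = E.twoTorsionPolynomial.toPoly.rootSet Ω) (x : Ω) :
    x ∈ S.pts ↔ 4 * x ^ 3 + algebraMap F Ω E.b₂ * x ^ 2 + 2 * algebraMap F Ω E.b₄ * x +
      algebraMap F Ω E.b₆ = 0 := by
  classical
  have h4 : (algebraMap F Ω) 4 = 4 := map_ofNat _ 4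
  have h2 : (algebraMap F Ω) 2 = 2 := map_ofNat _ 2
  have h0 : (Cubic.map (algebraMap F Ω) E.twoTorsionPolynomial).toPoly ≠ 0 :=
    Cubic.ne_zero_of_a_ne_zero (by
      change (algebraMap F Ω) 4 ≠ 0
      exact (_root_.map_ne_zero _).mpr (by norm_num))
  rw [← Finset.mem_coe, hS, rootSet_def, Finset.mem_coe, Multiset.mem_toFinset, aroots_def,
    ← Cubic.map_toPoly, ← Cubic.roots, Cubic.mem_roots_iff h0]
  simp only [Cubic.map, WeierstrassCurve.twoTorsionPolynomial, map_mul, h4, h2]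

/-- Over a NUMBER FIELD `F` (print: `F` a number field, Def. 3.1 (a)(b)) every strictly critical
point is ALGEBRAIC over `ℚ` — the standing hypothesis `hS` of
`CriticalLocus.existsKappaCoricDegreeFour_holds` / `everyValueAttained_holds`
(`KappaCoricFunctionsExistence.lean`), met at the printed locus. [claim: Mochizuki2012, status: disputed] -/
theorem isAlgebraic_of_coe_pts_eq [NumberField F] [CharZero Ω] (E : WeierstrassCurve F)
    (S : CriticalLocus Ω) (hS : (S.pts : Set Ω) = E.twoTorsionPolynomial.toPoly.rootSet Ω) :
    ∀ e ∈ S.pts, IsAlgebraic ℚ e := by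
  intro e he
  have he' : e ∈ E.twoTorsionPolynomial.toPoly.rootSet Ω := by
    rw [← hS]; exact Finset.mem_coe.mpr he
  have hF : IsAlgebraic F e := isAlgebraic_of_mem_rootSet he'
  haveI : IsScalarTower ℚ F Ω :=
    IsScalarTower.of_algebraMap_eq fun q => by simp only [eq_ratCast, map_ratCast]
  exact hF.restrictScalars ℚ

/-- **Rmk 3.1.7 (ii), p. 67, NON-VACUOUS AT THE GENUINE CRITICAL LOCUS.** For every elliptic
curve `E` over a number field `F` and every algebraically closed `Ω ⊇ F` there is a critical locus
`S` — the `2`-torsion `x`-coordinates of `E` — at which BOTH printed existence claims hold: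
"there exists a `κ`-coric `f_sol ∈ L_C` of degree `4`" and "every element of `L̄` appears as a value
of some `κ`-coric rational function on `C_L` at some `L̄`-valued point of `C_L` that is not
critical" (by the landed dischargers, whose algebraicity hypothesis is
`isAlgebraic_of_coe_pts_eq`). [claim: Mochizuki2012, status: disputed] -/
theorem exists_twoTorsion_rmk317ii [NumberField F] [CharZero Ω] [IsAlgClosed Ω]
    (E : WeierstrassCurve F) [E.IsElliptic] :
    ∃ S : CriticalLocus Ω, (S.pts : Set Ω) = E.twoTorsionPolynomial.toPoly.rootSet Ω ∧
      S.ExistsKappaCoricDegreeFour ∧ S.EveryValueAttained Set.univ := by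
  obtain ⟨S, hS⟩ := exists_coe_pts_eq_rootSet_twoTorsion (Ω := Ω) E
  exact ⟨S, hS, S.existsKappaCoricDegreeFour_holds (isAlgebraic_of_coe_pts_eq E S hS),
    S.everyValueAttained_holds (isAlgebraic_of_coe_pts_eq E S hS)⟩

/-- **`CriticalLocus` is inhabited at a genuine model** for every algebraically closed field `Ω`
of characteristic `0`: the `2`-torsion locus of the elliptic curve `WeierstrassCurve.ofJ 1728`
over `ℚ` (`y² = x³ + x`), read in `Ω`. [claim: Mochizuki2012, status: disputed] -/
theorem nonempty_model [CharZero Ω] [IsAlgClosed Ω] : Nonempty (CriticalLocus Ω) := by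
  obtain ⟨S, -⟩ :=
    exists_coe_pts_eq_rootSet_twoTorsion (Ω := Ω) (WeierstrassCurve.ofJ (1728 : ℚ))
  exact ⟨S⟩

/-- The same model also carries Rmk 3.1.7 (ii): in every algebraically closed `Ω` of
characteristic `0` SOME critical locus admits a `κ`-coric function of degree `4` and attains every
value of `Ω` by `κ`-coric functions off the critical points. [claim: Mochizuki2012, status: disputed] -/
theorem exists_rmk317ii_model [CharZero Ω] [IsAlgClosed Ω] :
    ∃ S : CriticalLocus Ω, S.ExistsKappaCoricDegreeFour ∧ S.EveryValueAttained Set.univ := by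
  obtain ⟨S, -, h⟩ := exists_twoTorsion_rmk317ii (Ω := Ω) (WeierstrassCurve.ofJ (1728 : ℚ))
  exact ⟨S, h⟩

end Literature.IUT.HodgeTheaters.CriticalLocus
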